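import Mathlib
import Summits.Ventures.PercRepro2.PMK5Typed
import Summits.Ventures.PercRepro2.PMK5Strict
import Summits.Ventures.PercRepro2.PMK5Locus
import Summits.Ventures.PercRepro2.PMK5LocusFace
import Summits.Ventures.PercRepro2.PMK5LocusZero
import Summits.Ventures.PercRepro2.PMK5LocusC4

/-!
# THE EQUALITY LOCUS OF `(C4)` ON FIVE-VERTEX BASES — THE ZERO SIDE AND THE TWO «IFF»s
(blind cell PercRepro2, mine-2 g23; the `C4`-companion of `PMK5LocusZero.lean`; on `PMK5LocusC4.lean` (the
positive side, `RuleC4`) and `PMK5LocusFace.lean` (restricted tables and their Kronecker numbers); row 2′BETA1)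

The `C4`-degenerate edge sets (`RuleC4`, the exact zero set of the class sums of `(C4)`) form a down-set
with 8 maximal elements `MxC4` (`coverZC4`, one `decide +kernel`); on each of them the positive and the negative
restricted Kronecker numbers are EQUAL (`faceC4_*`, 8 `decide +kernel`), so every coefficient supported inside a
degenerate face vanishes (`coefC4_eq_of_face`), whence `c4_K5_zero_of_face`, and the two «iff»s
`c4_K5_pos_iff` / `c4_K5_zero_iff` (the centre of the face separates the cases).  Standard axioms.
-/

namespace Summit.Ventures.PercRepro2

open Hub

namespace K5

namespace PM

/-- The positive part of the cleared `(C4)` on the face `m` (`kPosC4` with restricted tables). -/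
def kPosC4m (m : ℕ) : ℕ := kp (restr m tQBLHuLo) (restr m tQ) (restr m tQ) +
  kp (restr m tQBL) (restr m tQHu) (restr m tQoU)
/-- The negative part of the cleared `(C4)` on the face `m`. -/
def kNegC4m (m : ℕ) : ℕ := kp (restr m tQBL) (restr m tQHuLo) (restr m tQ) +
  kp (restr m tQoU) (restr m tQ) (restr m tQBLHu)
/-- The positive triple counts of `(C4)` on the face `m`. -/
def cntPosC4m (m : ℕ) (k : Fin 10 → Fin 4) : ℕ := cnt3 (restr m tQBLHuLo) (restr m tQ) (restr m tQ) k +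
  cnt3 (restr m tQBL) (restr m tQHu) (restr m tQoU) k
/-- The negative triple counts of `(C4)` on the face `m`. -/
def cntNegC4m (m : ℕ) (k : Fin 10 → Fin 4) : ℕ := cnt3 (restr m tQBL) (restr m tQHuLo) (restr m tQ) k +
  cnt3 (restr m tQoU) (restr m tQ) (restr m tQBLHu) k
/-- `kPosC4m` carries the restricted positive counts. -/
lemma kPosC4m_eq (m : ℕ) : kPosC4m m = ∑ k, cntPosC4m m k * KB ^ idx4 k := by
  unfold kPosC4m cntPosC4m
  simp only [kp_eq]
  exact sum_add_mul5 _ _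
/-- `kNegC4m` carries the restricted negative counts. -/
lemma kNegC4m_eq (m : ℕ) : kNegC4m m = ∑ k, cntNegC4m m k * KB ^ idx4 k := by
  unfold kNegC4m cntNegC4m
  simp only [kp_eq]
  exact sum_add_mul5 _ _
/-- The restricted counts are Kronecker digits (`2 · 3^10 < 2^19`). -/
lemma cntPosC4m_lt (m : ℕ) (k : Fin 10 → Fin 4) : cntPosC4m m k < 2 ^ 19 := by
  unfold cntPosC4m
  have := cnt3_le (restr m tQBLHuLo) (restr m tQ) (restr m tQ) k
  have := cnt3_le (restr m tQBL) (restr m tQHu) (restr m tQoU) k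
  omega
/-- The restricted counts are Kronecker digits. -/
lemma cntNegC4m_lt (m : ℕ) (k : Fin 10 → Fin 4) : cntNegC4m m k < 2 ^ 19 := by
  unfold cntNegC4m
  have := cnt3_le (restr m tQBL) (restr m tQHuLo) (restr m tQ) k
  have := cnt3_le (restr m tQoU) (restr m tQ) (restr m tQBLHu) k
  omega

/-! ## The 8 maximal `C4`-degenerate faces (kernel) -/

set_option maxRecDepth 100000 in
/-- The restricted numbers of `(C4)` agree on the face `379` = {01 02 04 12 13 14 24}. -/
theorem faceC4_379 : kPosC4m 379 = kNegC4m 379 := by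
  decide +kernel

set_option maxRecDepth 100000 in
/-- The restricted numbers of `(C4)` agree on the face `442` = {02 04 12 13 23 24}. -/
theorem faceC4_442 : kPosC4m 442 = kNegC4m 442 := by
  decide +kernel

set_option maxRecDepth 100000 in
/-- The restricted numbers of `(C4)` agree on the face `503` = {01 02 03 12 13 14 23 24}. -/
theorem faceC4_503 : kPosC4m 503 = kNegC4m 503 := by
  decide +kernel

set_option maxRecDepth 100000 in
/-- The restricted numbers of `(C4)` agree on the face `627` = {01 02 12 13 14 34}. -/
theorem faceC4_627 : kPosC4m 627 = kNegC4m 627 := by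
  decide +kernel

set_option maxRecDepth 100000 in
/-- The restricted numbers of `(C4)` agree on the face `637` = {01 03 04 12 13 14 34}. -/
theorem faceC4_637 : kPosC4m 637 = kNegC4m 637 := by
  decide +kernel

set_option maxRecDepth 100000 in
/-- The restricted numbers of `(C4)` agree on the face `915` = {01 02 12 23 24 34}. -/
theorem faceC4_915 : kPosC4m 915 = kNegC4m 915 := by
  decide +kernel

set_option maxRecDepth 100000 in
/-- The restricted numbers of `(C4)` agree on the face `926` = {02 03 04 12 23 24 34}. -/
theorem faceC4_926 : kPosC4m 926 = kNegC4m 926 := by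
  decide +kernel

set_option maxRecDepth 100000 in
/-- The restricted numbers of `(C4)` agree on the face `1009` = {01 12 13 14 23 24 34}. -/
theorem faceC4_1009 : kPosC4m 1009 = kNegC4m 1009 := by
  decide +kernel

/-- **Every coefficient of `(C4)` supported inside a face with equal restricted numbers vanishes.** -/
theorem coefC4_eq_of_face (m : ℕ) (hz : kPosC4m m = kNegC4m m) (k : Fin 10 → Fin 4)
    (hk : ∀ e : Fin 10, k e ≠ 0 → m.testBit e = true) : cntPosC4 k = cntNegC4 k := by
  have h := eq_of_kron_eq _ _ (cntPosC4m_lt m) (cntNegC4m_lt m) (kPosC4m_eq m) (kNegC4m_eq m) hz k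
  unfold cntPosC4m cntNegC4m at h
  simp only [cnt3_restr_eq hk] at h
  unfold cntPosC4 cntNegC4
  omega

/-- The 8 maximal `C4`-degenerate edge sets. -/
def MxC4 : Fin 8 → ℕ := ![379, 442, 503, 627, 637, 915, 926, 1009]

set_option maxRecDepth 100000 in
/-- **Every `C4`-degenerate edge set lies inside one of the maximal ones.** -/
theorem coverZC4 : ∀ m : Fin 1024, RuleC4 m = true →
    ∃ i : Fin 8, ∀ e : Fin 10, (m : ℕ).testBit e = true → (MxC4 i).testBit e = true := by
  decide +kernel

/-- The restricted numbers agree on each maximal `C4`-degenerate face. -/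
theorem faceC4_all : ∀ i : Fin 8, kPosC4m (MxC4 i) = kNegC4m (MxC4 i) := by
  intro i
  fin_cases i
  exacts [faceC4_379, faceC4_442, faceC4_503, faceC4_627, faceC4_637, faceC4_915, faceC4_926, faceC4_1009]

section Face

variable {R : Type*} [Field R] [LinearOrder R] [IsStrictOrderedRing R]

omit [LinearOrder R] [IsStrictOrderedRing R] in
/-- **THE EQUALITY LOCUS OF `(C4)` — THE ZERO SIDE**: on every `C4`-degenerate edge set `m` the cleared
`(C4)` vanishes at every weight vector supported on `m`. -/
theorem c4_K5_zero_of_face (m : ℕ) (hm : m < 1024) (hr : RuleC4 m = true) (p : Fin 10 → R)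
    (hp₀ : ∀ e : Fin 10, m.testBit e = false → p e = 0) :
    
    prob p (connEvent ends5 1 2)ᶜ *
          (prob p (connEvent ends5 1 2)ᶜ *
              prob p (connEvent ends5 1 4 ∩ connEvent ends5 2 3 ∩ connEvent ends5 1 0 ∩
                (connEvent ends5 1 2)ᶜ) -
            prob p (connEvent ends5 1 4 ∩ (connEvent ends5 1 2)ᶜ) *
              prob p (connEvent ends5 2 3 ∩ connEvent ends5 1 0 ∩ (connEvent ends5 1 2)ᶜ)) -
        prob p ((connEvent ends5 1 0 ∪ connEvent ends5 2 0) ∩ (connEvent ends5 1 2)ᶜ) *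
          (prob p (connEvent ends5 1 2)ᶜ *
              prob p (connEvent ends5 1 4 ∩ connEvent ends5 2 3 ∩ (connEvent ends5 1 2)ᶜ) -
            prob p (connEvent ends5 1 4 ∩ (connEvent ends5 1 2)ᶜ) *
              prob p (connEvent ends5 2 3 ∩ (connEvent ends5 1 2)ᶜ)) = 0 := by
  rw [c4_eq_bern]
  refine Finset.sum_eq_zero fun k _ => ?_
  by_cases hk : ∀ e : Fin 10, k e ≠ 0 → m.testBit e = true
  · obtain ⟨i, hi⟩ := coverZC4 ⟨m, hm⟩ hr
    have hc := coefC4_eq_of_face (MxC4 i) (faceC4_all i) k fun e he => hi e (hk e he)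
    rw [hc, sub_self, mul_zero]
  · obtain ⟨e, he⟩ := not_forall.1 hk
    obtain ⟨hke, hme⟩ := Classical.not_imp.1 he
    have hpe : p e = 0 := hp₀ e (by simpa using hme)
    have hb : bern p k = 0 := by
      unfold bern
      apply Finset.prod_eq_zero (Finset.mem_univ e)
      rw [hpe, zero_pow (fun h => hke (Fin.ext (by simpa using h)))]
      simp
    rw [hb, zero_mul]

/-- **THE EQUALITY LOCUS OF `(C4)`, FIRST «IFF»**: strictly positive on the whole open face ⟺ not
`C4`-degenerate. -/
theorem c4_K5_pos_iff (m : ℕ) (hm : m < 1024) :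
    (∀ p : Fin 10 → R, (∀ e : Fin 10, m.testBit e = true → 0 < p e ∧ p e < 1) →
      (∀ e : Fin 10, m.testBit e = false → p e = 0) →
      0 < 
    prob p (connEvent ends5 1 2)ᶜ *
          (prob p (connEvent ends5 1 2)ᶜ *
              prob p (connEvent ends5 1 4 ∩ connEvent ends5 2 3 ∩ connEvent ends5 1 0 ∩
                (connEvent ends5 1 2)ᶜ) -
            prob p (connEvent ends5 1 4 ∩ (connEvent ends5 1 2)ᶜ) *
              prob p (connEvent ends5 2 3 ∩ connEvent ends5 1 0 ∩ (connEvent ends5 1 2)ᶜ)) -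
        prob p ((connEvent ends5 1 0 ∪ connEvent ends5 2 0) ∩ (connEvent ends5 1 2)ᶜ) *
          (prob p (connEvent ends5 1 2)ᶜ *
              prob p (connEvent ends5 1 4 ∩ connEvent ends5 2 3 ∩ (connEvent ends5 1 2)ᶜ) -
            prob p (connEvent ends5 1 4 ∩ (connEvent ends5 1 2)ᶜ) *
              prob p (connEvent ends5 2 3 ∩ (connEvent ends5 1 2)ᶜ))) ↔ RuleC4 m = false := by
  constructor
  · intro h
    rcases Bool.eq_false_or_eq_true (RuleC4 m) with hr | hr
    · exfalso
      have hpos := h (centre (R := R) m) (fun e he => centre_on_pos he) (fun e he => centre_off he)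
      have hzero := c4_K5_zero_of_face m hm hr (centre (R := R) m) (fun e he => centre_off he)
      rw [hzero] at hpos
      exact lt_irrefl _ hpos
    · exact hr
  · intro hr p hp₁ hp₀
    exact c4_K5_pos_of_face m hm hr p hp₁ hp₀

/-- **THE EQUALITY LOCUS OF `(C4)`, SECOND «IFF»**: identically zero on the face ⟺ `C4`-degenerate. -/
theorem c4_K5_zero_iff (m : ℕ) (hm : m < 1024) :
    (∀ p : Fin 10 → R, (∀ e : Fin 10, 0 ≤ p e ∧ p e ≤ 1) →
      (∀ e : Fin 10, m.testBit e = false → p e = 0) →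
      
    prob p (connEvent ends5 1 2)ᶜ *
          (prob p (connEvent ends5 1 2)ᶜ *
              prob p (connEvent ends5 1 4 ∩ connEvent ends5 2 3 ∩ connEvent ends5 1 0 ∩
                (connEvent ends5 1 2)ᶜ) -
            prob p (connEvent ends5 1 4 ∩ (connEvent ends5 1 2)ᶜ) *
              prob p (connEvent ends5 2 3 ∩ connEvent ends5 1 0 ∩ (connEvent ends5 1 2)ᶜ)) -
        prob p ((connEvent ends5 1 0 ∪ connEvent ends5 2 0) ∩ (connEvent ends5 1 2)ᶜ) *
          (prob p (connEvent ends5 1 2)ᶜ *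
              prob p (connEvent ends5 1 4 ∩ connEvent ends5 2 3 ∩ (connEvent ends5 1 2)ᶜ) -
            prob p (connEvent ends5 1 4 ∩ (connEvent ends5 1 2)ᶜ) *
              prob p (connEvent ends5 2 3 ∩ (connEvent ends5 1 2)ᶜ)) = 0) ↔ RuleC4 m = true := by
  constructor
  · intro h
    rcases Bool.eq_false_or_eq_true (RuleC4 m) with hr | hr
    · exact hr
    · exfalso
      have hpos := c4_K5_pos_of_face m hm hr (centre (R := R) m)
        (fun e he => centre_on_pos he) (fun e he => centre_off he)
      have hzero := h (centre (R := R) m) (centre_01 m) (fun e he => centre_off he)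
      rw [hzero] at hpos
      exact lt_irrefl _ hpos
  · intro hr p _ hp₀
    exact c4_K5_zero_of_face m hm hr p hp₀

end Face

end PM

end K5

end Summit.Ventures.PercRepro2
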